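import Mathlib
import HarnessLib.Audit
import Summits.PneNP.PneNP.Theorems.PstarGateNodes

/-!
# One GATED chord: the residual nodes on an XOR-CLOSED core (v2 of `PstarGateNodes`: the bundle `GateDataX`), coverage and the link (E2; prover-1 g18)

FRONTIER range-avoidance ladder, rung F-N3 (`stmt-PneNP-19007`), cell `pnp-ideate`; restricted-model proof complexity — nothing here bears on `P` versus `NP`.

CORRECTION of the bundle of `PstarGateNodes` (landed minutes earlier, p685390): `GateData` omits the XOR-closedness of the core `J₀`, which the raw
datum has (`PstarCoreBoundTargets.Terminal`) and which the counts need (`PstarNorUnitRegime.J₀_eq_of_single`: with `N = {e}` an XOR-closed core IS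
the cycle `D e + e`; without it, tree edges pendant to the cycle and read through their leaf variables are not excluded by `GateData` alone, and the
v1 nodes would have to count them).  This file adds the closedness and re-types the layer; the v1 nodes of `PstarGateNodes` remain as the (stronger,
pendant-tolerant) statements and imply the v2 ones (`…X_of_…`).

* `GateDataX I r B e g₀ u κ₀ := XorClosed I B.J₀ ∧ GateData I r B e g₀ u κ₀`; target `GateCountX`; nodes N1–N6′ (v2): `GateCasePNorX`, `GateCasePUnitsX`,
  `GateOrFamilyX`, `GateCaseTQuadX`, `GateU2X`, `GateUnitCycleQuadX`, `GateUnitCycleAffineX` (statements = the planner's N1–N6′ with `GateDataX`);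
  `GateCoverageX`.
* PROVED: `gateCoverageX_holds : GateCoverageX` (as `gateCoverage_holds`); `gateDataX_of_terminal`; **`cotree1Blind_of_gateCountX : GateCountX →
  TerminalFiveCotree1Blind`** (both orientations, slot 3 through `swapAnd I e`); `gateCountX_of_gateCount` and the seven `…X_of_…` (v1 ⟹ v2).
So (E2) `TerminalFiveCotree1Blind` ⟸ `GateCountX` ⟸ N1X ∧ N2X ∧ N3X ∧ N4X ∧ N5X ∧ N6X ∧ N6′X — the seven typed finite problems, now on closed cores.
-/

set_option linter.dupNamespace false -- `Summit.PneNP.PneNP.…`: summit = sub-problem name (D-0017 single-conjunct layout)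

open Finset Literature.Computability.Complexity
open Summit.PneNP.PneNP.Theorems.PstarTyped (Typed)
open Summit.PneNP.PneNP.Theorems.PstarSALevel (BoundaryExpanding SimpleOverlap)
open Summit.PneNP.PneNP.Theorems.PstarCoreBound (XorClosed)
open Summit.PneNP.PneNP.Theorems.PstarChordRepair (IsChord)
open Summit.PneNP.PneNP.Theorems.PstarCubeIdeals (IsAffineFn)
open Summit.PneNP.PneNP.Theorems.PstarReadSumset (V2)
open Summit.PneNP.PneNP.Theorems.PstarChordSystem (ChordSystem)
open Summit.PneNP.PneNP.Theorems.PstarChordBridgeTools (privs coef mem_privs)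
open Summit.PneNP.PneNP.Theorems.PstarChordBridge (BridgeData sys Solution Lift infeasible_of_not_solution chordMinimal_of_solution_erase)
open Summit.PneNP.PneNP.Theorems.PstarChordBridgeCotree (Peelable)
open Summit.PneNP.PneNP.Theorems.PstarChordBridgeForcing (gam)
open Summit.PneNP.PneNP.Theorems.PstarChordBridgeBasis (qDir)
open Summit.PneNP.PneNP.Theorems.PstarCoreBoundTargets (Terminal)
open Summit.PneNP.PneNP.Theorems.PstarUnion (SatPair)
open Summit.PneNP.PneNP.Theorems.PstarCoupled (CotreeGate TerminalFiveCotree1Blind)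
open Summit.PneNP.PneNP.Theorems.PstarGateBridge (GateHyp const_of_others regime_trichotomy)
open Summit.PneNP.PneNP.Theorems.PstarGateCasePRegimes (NorCert)
open Summit.PneNP.PneNP.Theorems.PstarSlotSwap
open Summit.PneNP.PneNP.Theorems.PstarGateNodes

namespace Summit.PneNP.PneNP.Theorems.PstarGateNodesX

variable {n m : ℕ}

/-- **The one-gate bridge-data bundle on an XOR-closed core** (v2 of `PstarGateNodes.GateData`). -/
def GateDataX (I : LocalMap 4 n m) (r : ℕ) (B : BridgeData n m) (e g₀ : Fin m) (u : Fin n) (κ₀ : ZMod 2) : Prop :=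
  XorClosed I B.J₀ ∧ GateData I r B e g₀ u κ₀

/-- The common target, v2: one-gate bridge data on an XOR-closed core have a core of at most five outputs. -/
@[conjecture] def GateCountX : Prop :=
  ∀ (n m r : ℕ) (I : LocalMap 4 n m), I.IsPure xorAndPred → Typed I → SimpleOverlap I → BoundaryExpanding r I →
  ∀ (B : BridgeData n m) (e g₀ : Fin m) (u : Fin n) (κ₀ : ZMod 2), GateDataX I r B e g₀ u κ₀ → B.J₀.card ≤ 5

/-- **N1 (v2) `GateCasePNorX`** — CASE P with some other chord (NOR) w.r.t. `q_{(1,0)}`, on an XOR-closed core. -/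
@[conjecture] def GateCasePNorX : Prop :=
  ∀ (n m r : ℕ) (I : LocalMap 4 n m), I.IsPure xorAndPred → Typed I → SimpleOverlap I → BoundaryExpanding r I →
  ∀ (B : BridgeData n m) (e g₀ : Fin m) (u : Fin n) (κ₀ : ZMod 2), GateDataX I r B e g₀ u κ₀ →
    ReadAlong I B e (1, 0) → AllRead I B e →
    (∃ e' ∈ B.N, e' ≠ e ∧ NorCert I B (B.D e') (gam B e')) →
    B.J₀.card ≤ 5

/-- **N2 (v2) `GateCasePUnitsX`** — CASE P, at least one other chord, none (NOR), on an XOR-closed core. -/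
@[conjecture] def GateCasePUnitsX : Prop :=
  ∀ (n m r : ℕ) (I : LocalMap 4 n m), I.IsPure xorAndPred → Typed I → SimpleOverlap I → BoundaryExpanding r I →
  ∀ (B : BridgeData n m) (e g₀ : Fin m) (u : Fin n) (κ₀ : ZMod 2), GateDataX I r B e g₀ u κ₀ →
    ReadAlong I B e (1, 0) → AllRead I B e → (B.N.erase e).Nonempty →
    (∀ e' ∈ B.N, e' ≠ e → ¬ NorCert I B (B.D e') (gam B e')) →
    B.J₀.card ≤ 5

/-- **N3 (v2) `GateOrFamilyX`** — CASE T with `q_mv` affine and another chord (the OR-reader family), on an XOR-closed core. -/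
@[conjecture] def GateOrFamilyX : Prop :=
  ∀ (n m r : ℕ) (I : LocalMap 4 n m), I.IsPure xorAndPred → Typed I → SimpleOverlap I → BoundaryExpanding r I →
  ∀ (B : BridgeData n m) (e g₀ : Fin m) (u : Fin n) (κ₀ : ZMod 2), GateDataX I r B e g₀ u κ₀ →
    ∀ mv : V2, (mv = (0, 1) ∨ mv = (1, 1)) → ReadAlong I B e mv → AllRead I B e → (B.N.erase e).Nonempty →
    IsAffineFn (qDir I B mv) →
    B.J₀.card ≤ 5

/-- **N4 (v2) `GateCaseTQuadX`** — CASE T with `q_mv` not affine and another chord, on an XOR-closed core. -/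
@[conjecture] def GateCaseTQuadX : Prop :=
  ∀ (n m r : ℕ) (I : LocalMap 4 n m), I.IsPure xorAndPred → Typed I → SimpleOverlap I → BoundaryExpanding r I →
  ∀ (B : BridgeData n m) (e g₀ : Fin m) (u : Fin n) (κ₀ : ZMod 2), GateDataX I r B e g₀ u κ₀ →
    ∀ mv : V2, (mv = (0, 1) ∨ mv = (1, 1)) → ReadAlong I B e mv → AllRead I B e → (B.N.erase e).Nonempty →
    ¬ IsAffineFn (qDir I B mv) →
    B.J₀.card ≤ 5

/-- **N5 (v2) `GateU2X`** — one other chord read in two independent directions, on an XOR-closed core. -/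
@[conjecture] def GateU2X : Prop :=
  ∀ (n m r : ℕ) (I : LocalMap 4 n m), I.IsPure xorAndPred → Typed I → SimpleOverlap I → BoundaryExpanding r I →
  ∀ (B : BridgeData n m) (e g₀ : Fin m) (u : Fin n) (κ₀ : ZMod 2), GateDataX I r B e g₀ u κ₀ →
    ∀ e' : Fin m, B.N = {e, e'} → e' ≠ e →
    (∀ a, (sys I B).ρ e' a ≠ 0 ∧ (sys I B).ρ' e' a ≠ 0 ∧ (sys I B).ρ e' a ≠ (sys I B).ρ' e' a) →
    B.J₀.card ≤ 5

/-- **N6 (v2) `GateUnitCycleQuadX`** — the gated chord is the only chord and `q_{(1,0)}` is not affine, on an XOR-closed core (so `J₀ = D e + e`). -/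
@[conjecture] def GateUnitCycleQuadX : Prop :=
  ∀ (n m r : ℕ) (I : LocalMap 4 n m), I.IsPure xorAndPred → Typed I → SimpleOverlap I → BoundaryExpanding r I →
  ∀ (B : BridgeData n m) (e g₀ : Fin m) (u : Fin n) (κ₀ : ZMod 2), GateDataX I r B e g₀ u κ₀ →
    B.N = {e} → ¬ IsAffineFn (qDir I B (1, 0)) →
    B.J₀.card ≤ 5

/-- **N6′ (v2) `GateUnitCycleAffineX`** — the gated chord is the only chord and `q_{(1,0)}` is affine, on an XOR-closed core (so `J₀ = D e + e`). -/
@[conjecture] def GateUnitCycleAffineX : Prop :=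
  ∀ (n m r : ℕ) (I : LocalMap 4 n m), I.IsPure xorAndPred → Typed I → SimpleOverlap I → BoundaryExpanding r I →
  ∀ (B : BridgeData n m) (e g₀ : Fin m) (u : Fin n) (κ₀ : ZMod 2), GateDataX I r B e g₀ u κ₀ →
    B.N = {e} → IsAffineFn (qDir I B (1, 0)) →
    B.J₀.card ≤ 5

/-- **Coverage (v2)**: the seven closed-core nodes exhaust closed-core one-gate bridge data. -/
def GateCoverageX : Prop :=
  GateCasePNorX → GateCasePUnitsX → GateOrFamilyX → GateCaseTQuadX → GateU2X → GateUnitCycleQuadX → GateUnitCycleAffineX → GateCountX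

/-! ## v1 ⟹ v2 -/

/-- v1 ⟹ v2 for the target. -/
theorem gateCountX_of_gateCount (h : GateCount) : GateCountX :=
  fun n m r I hI hT hS hB B e g₀ u κ₀ hD => h n m r I hI hT hS hB B e g₀ u κ₀ hD.2

/-- v1 ⟹ v2 for N1. -/
theorem gateCasePNorX_of (h : GateCasePNor) : GateCasePNorX :=
  fun n m r I hI hT hS hB B e g₀ u κ₀ hD => h n m r I hI hT hS hB B e g₀ u κ₀ hD.2

/-- v1 ⟹ v2 for N2. -/
theorem gateCasePUnitsX_of (h : GateCasePUnits) : GateCasePUnitsX :=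
  fun n m r I hI hT hS hB B e g₀ u κ₀ hD => h n m r I hI hT hS hB B e g₀ u κ₀ hD.2

/-- v1 ⟹ v2 for N3. -/
theorem gateOrFamilyX_of (h : GateOrFamily) : GateOrFamilyX :=
  fun n m r I hI hT hS hB B e g₀ u κ₀ hD => h n m r I hI hT hS hB B e g₀ u κ₀ hD.2

/-- v1 ⟹ v2 for N4. -/
theorem gateCaseTQuadX_of (h : GateCaseTQuad) : GateCaseTQuadX :=
  fun n m r I hI hT hS hB B e g₀ u κ₀ hD => h n m r I hI hT hS hB B e g₀ u κ₀ hD.2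

/-- v1 ⟹ v2 for N5. -/
theorem gateU2X_of (h : GateU2) : GateU2X :=
  fun n m r I hI hT hS hB B e g₀ u κ₀ hD => h n m r I hI hT hS hB B e g₀ u κ₀ hD.2

/-- v1 ⟹ v2 for N6. -/
theorem gateUnitCycleQuadX_of (h : GateUnitCycleQuad) : GateUnitCycleQuadX :=
  fun n m r I hI hT hS hB B e g₀ u κ₀ hD => h n m r I hI hT hS hB B e g₀ u κ₀ hD.2

/-- v1 ⟹ v2 for N6′. -/
theorem gateUnitCycleAffineX_of (h : GateUnitCycleAffine) : GateUnitCycleAffineX :=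
  fun n m r I hI hT hS hB B e g₀ u κ₀ hD => h n m r I hI hT hS hB B e g₀ u κ₀ hD.2

/-! ## Coverage -/

/-- **Coverage (v2)** — the proof of `gateCoverage_holds`, carrying the closedness along. -/
theorem gateCoverageX_holds : GateCoverageX := by
  intro h1 h2 h3 h4 h5 h6 h6' n m r I hI hT hS hB B e g₀ u κ₀ hD
  classical
  obtain ⟨hW, hr, -, -, hL, -, -, hG, -, -, -, -, -, -, -, hT3, hM0⟩ := id hD.2
  have he : e ∈ B.N := hG.1
  have hJr : B.J₀.card ≤ r := (card_le_card (subset_union_left.trans subset_union_left)).trans hr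
  have hconst := const_of_others I hW hG
  have hinf : (sys I B).Infeasible B.N := infeasible_of_not_solution I hI hT hW hL hT3
  have hM0N : ∀ f ∈ B.N, ∃ z, Solution I B (B.J₀.erase f) z := fun f hf => hM0 f (hW.hN hf)
  have hread : AllRead I B e := by
    intro e' he' hne a
    obtain ⟨z, hz⟩ := hM0N e' he'
    obtain ⟨a₀, -, -, -, hR⟩ := (sys I B).read_of_chordMinimal hinf he' (chordMinimal_of_solution_erase I hI hT hW he' hz)
    unfold ChordSystem.Read at hR
    rw [(hconst e' he' hne a a₀).1, (hconst e' he' hne a a₀).2]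
    exact hR
  have caseP : ReadAlong I B e (1, 0) → (B.N.erase e).Nonempty → B.J₀.card ≤ 5 := by
    intro hRA hne
    by_cases hnor : ∃ e' ∈ B.N, e' ≠ e ∧ NorCert I B (B.D e') (gam B e')
    · exact h1 n m r I hI hT hS hB B e g₀ u κ₀ hD hRA hread hnor
    · push Not at hnor
      exact h2 n m r I hI hT hS hB B e g₀ u κ₀ hD hRA hread hne hnor
  have caseT : ∀ mv : V2, (mv = (0, 1) ∨ mv = (1, 1)) → ReadAlong I B e mv → (B.N.erase e).Nonempty → B.J₀.card ≤ 5 := by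
    intro mv hmv hRA hne
    by_cases haff : IsAffineFn (qDir I B mv)
    · exact h3 n m r I hI hT hS hB B e g₀ u κ₀ hD mv hmv hRA hread hne haff
    · exact h4 n m r I hI hT hS hB B e g₀ u κ₀ hD mv hmv hRA hread hne haff
  have hothers : ∀ f ∈ B.N, f ≠ e → f ∈ B.N.erase e := fun f hf hfe => mem_erase.2 ⟨hfe, hf⟩
  rcases Nat.lt_or_ge (B.N.erase e).card 2 with hlt | hge
  · rcases Nat.lt_or_ge (B.N.erase e).card 1 with h0 | h1'
    · have h0' : B.N.erase e = ∅ := card_eq_zero.1 (by omega)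
      have hNe : B.N = {e} := by
        ext f
        rw [mem_singleton]
        refine ⟨fun hf => ?_, fun hf => hf ▸ he⟩
        by_contra hfe
        have h := hothers f hf hfe
        rw [h0'] at h
        exact notMem_empty _ h
      by_cases haff : IsAffineFn (qDir I B (1, 0))
      · exact h6' n m r I hI hT hS hB B e g₀ u κ₀ hD hNe haff
      · exact h6 n m r I hI hT hS hB B e g₀ u κ₀ hD hNe haff
    · obtain ⟨e', he'⟩ := card_eq_one.1 (show (B.N.erase e).card = 1 by omega)
      have he'mem : e' ∈ B.N.erase e := by rw [he']; exact mem_singleton_self _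
      obtain ⟨hne, he'N⟩ := mem_erase.1 he'mem
      have huniq : ∀ f ∈ B.N, f ≠ e → f = e' := fun f hf hfe => by
        have h := hothers f hf hfe
        rw [he'] at h
        exact mem_singleton.1 h
      have hNe : B.N = {e, e'} := by
        ext f
        rw [mem_insert, mem_singleton]
        refine ⟨fun hf => ?_, ?_⟩
        · by_cases hfe : f = e
          · exact Or.inl hfe
          · exact Or.inr (huniq f hf hfe)
        · rintro (rfl | rfl)
          exacts [he, he'N]
      rcases v2_line_or_indep ((sys I B).ρ e' 0) ((sys I B).ρ' e' 0) (hread e' he'N hne 0) with ⟨mv, hmv, hrm, hr'm⟩ | ⟨hr0, hr'0, hrr'⟩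
      · have hRA : ReadAlong I B e mv := by
          intro f hf hfe a
          rw [huniq f hf hfe, (hconst e' he'N hne a 0).1, (hconst e' he'N hne a 0).2]
          exact ⟨hrm, hr'm⟩
        rcases hmv with rfl | hmv'
        · exact caseP hRA ⟨e', he'mem⟩
        · exact caseT mv hmv' hRA ⟨e', he'mem⟩
      · exact h5 n m r I hI hT hS hB B e g₀ u κ₀ hD e' hNe hne fun a => by
          rw [(hconst e' he'N hne a 0).1, (hconst e' he'N hne a 0).2]; exact ⟨hr0, hr'0, hrr'⟩
  · rcases regime_trichotomy I hI hT hS hB hW hJr hL hG hT3 hM0N with hle | ⟨mv, -, hRA, -, hmv⟩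
    · omega
    have hne : (B.N.erase e).Nonempty := card_pos.1 (by omega)
    rcases hmv with rfl | hmv'
    · exact caseP hRA hne
    · exact caseT mv hmv' hRA hne

/-! ## The link to the raw datum -/

/-- **`GateDataX` from the raw datum** (orientation `p = vars e 2`): `gateData_of_terminal` plus the closedness of `Terminal`. -/
theorem gateDataX_of_terminal (I : LocalMap 4 n m) (hI : I.IsPure xorAndPred) (hT : Typed I) (hS : SimpleOverlap I) {r : ℕ}
    (hB : BoundaryExpanding r I) {y : Fin m → Bool} {J₀ : Finset (Fin m)} {w₁ w₂ : Finset (Fin n) × Finset (Fin m) × Bool}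
    (ht : Terminal I r y J₀ w₁ w₂) {F : Finset (Fin m)} (hF : F ⊆ J₀) (hP : Peelable I F)
    (hmax : ∀ F', F ⊆ F' → F' ⊆ J₀ → Peelable I F' → F' = F) (hch : ∀ e ∈ J₀ \ F, IsChord I J₀ e)
    {e : Fin m} (he : e ∈ J₀ \ F) {g₀ : Fin m} (hg₀ : g₀ ∈ w₁.2.1) {u : Fin n}
    (hgv : (I.vars g₀ 2 = I.vars e 2 ∧ I.vars g₀ 3 = u) ∨ (I.vars g₀ 2 = u ∧ I.vars g₀ 3 = I.vars e 2))
    (hu : ∃ j₀ ∈ F, u = I.vars j₀ 2 ∨ u = I.vars j₀ 3)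
    (hun : ∀ g ∈ (w₁.2.1.erase g₀) ∪ w₂.2.1, ∀ w ∈ privs I (J₀ \ F), I.vars g 2 ≠ w ∧ I.vars g 3 ≠ w)
    (hfv : ∀ c : Bool, SatPair I y J₀ (({I.vars e 2} : Finset (Fin n)), (∅ : Finset (Fin m)), c) w₂)
    (hbl : I.vars e 2 ∉ w₂.1 ∧ I.vars e 3 ∉ w₂.1) :
    ∃ (B : BridgeData n m) (κ₀ : ZMod 2), B.J₀ = J₀ ∧ GateDataX I r B e g₀ u κ₀ := by
  obtain ⟨B, κ₀, hJ, hD⟩ := gateData_of_terminal I hI hT hS hB ht hF hP hmax hch he hg₀ hgv hu hun hfv hbl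
  obtain ⟨-, hX, -⟩ := id ht
  exact ⟨B, κ₀, hJ, by rw [hJ]; exact hX, hD⟩

/-- The orientation-`2` half of the v2 link. -/
theorem card_le_five_of_gateCountX₂ (hC : GateCountX) (I : LocalMap 4 n m) (hI : I.IsPure xorAndPred) (hT : Typed I) (hS : SimpleOverlap I)
    {r : ℕ} (hB : BoundaryExpanding r I) {y : Fin m → Bool} {J₀ : Finset (Fin m)} {w₁ w₂ : Finset (Fin n) × Finset (Fin m) × Bool}
    (ht : Terminal I r y J₀ w₁ w₂) {F : Finset (Fin m)} (hF : F ⊆ J₀) (hP : Peelable I F)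
    (hmax : ∀ F', F ⊆ F' → F' ⊆ J₀ → Peelable I F' → F' = F) (hch : ∀ e ∈ J₀ \ F, IsChord I J₀ e)
    {e : Fin m} (he : e ∈ J₀ \ F) {g₀ : Fin m} (hg₀ : g₀ ∈ w₁.2.1) {u : Fin n}
    (hgv : (I.vars g₀ 2 = I.vars e 2 ∧ I.vars g₀ 3 = u) ∨ (I.vars g₀ 2 = u ∧ I.vars g₀ 3 = I.vars e 2))
    (hu : ∃ j₀ ∈ F, u = I.vars j₀ 2 ∨ u = I.vars j₀ 3)
    (hun : ∀ g ∈ (w₁.2.1.erase g₀) ∪ w₂.2.1, ∀ w ∈ privs I (J₀ \ F), I.vars g 2 ≠ w ∧ I.vars g 3 ≠ w)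
    (hfv : ∀ c : Bool, SatPair I y J₀ (({I.vars e 2} : Finset (Fin n)), (∅ : Finset (Fin m)), c) w₂)
    (hbl : I.vars e 2 ∉ w₂.1 ∧ I.vars e 3 ∉ w₂.1) : J₀.card ≤ 5 := by
  obtain ⟨B, κ₀, hJ, hD⟩ := gateDataX_of_terminal I hI hT hS hB ht hF hP hmax hch he hg₀ hgv hu hun hfv hbl
  rw [← hJ]
  exact hC n m r I hI hT hS hB B e g₀ u κ₀ hD

/-- **`GateCountX ⟹ TerminalFiveCotree1Blind`** (both orientations of the gate's private; slot `3` through `swapAnd I e`). -/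
theorem cotree1Blind_of_gateCountX (hC : GateCountX) : TerminalFiveCotree1Blind := by
  intro n m r I hI hT hS hB y J₀ w₁ w₂ ht F hF hP hmax hch g₀ hg₀ sp hcg hun h2 h3 hbl
  classical
  obtain ⟨hsp, hpriv, hu⟩ := hcg
  obtain ⟨v, u, hgv, hvp, hu', hfv, hbl'⟩ : ∃ v u : Fin n, ((I.vars g₀ 2 = v ∧ I.vars g₀ 3 = u) ∨ (I.vars g₀ 2 = u ∧ I.vars g₀ 3 = v)) ∧
      v ∈ privs I (J₀ \ F) ∧ (∃ j₀ ∈ F, u = I.vars j₀ 2 ∨ u = I.vars j₀ 3) ∧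
      (∀ c : Bool, SatPair I y J₀ (({v} : Finset (Fin n)), (∅ : Finset (Fin m)), c) w₂) ∧
      (∀ e ∈ J₀ \ F, (I.vars e 2 = v ∨ I.vars e 3 = v) → I.vars e 2 ∉ w₂.1 ∧ I.vars e 3 ∉ w₂.1) := by
    rcases hsp with rfl | rfl
    · rw [if_pos rfl] at hu
      exact ⟨_, _, Or.inl ⟨rfl, rfl⟩, hpriv, hu, h2, hbl⟩
    · rw [if_neg (by decide)] at hu
      exact ⟨_, _, Or.inr ⟨rfl, rfl⟩, hpriv, hu, h3, hbl⟩
  obtain ⟨e, he, hev⟩ := (mem_privs I).1 hvp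
  rcases hev with hev | hev
  · subst hev
    exact card_le_five_of_gateCountX₂ hC I hI hT hS hB ht hF hP hmax hch he hg₀ hgv hu' hun hfv (hbl' e he (Or.inl rfl))
  · subst hev
    set I' := swapAnd I e with hI'
    have hv2 : I'.vars e 2 = I.vars e 3 := (swapAnd_vars_two I e).1
    have hv3 : I'.vars e 3 = I.vars e 2 := (swapAnd_vars_two I e).2
    have hvo : ∀ {j : Fin m}, j ≠ e → ∀ s, I'.vars j s = I.vars j s := fun hj s => swapAnd_vars_of_ne I hj s
    have hg₀e : g₀ ≠ e := by
      obtain ⟨-, -, -, hd₁, -⟩ := id ht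
      exact fun h => Finset.disjoint_left.1 hd₁ (mem_sdiff.1 he).1 (h ▸ hg₀)
    have hch' : ∀ e' ∈ J₀ \ F, IsChord I' J₀ e' := fun e' he' => (isChord_swapAnd I e J₀ e').2 (hch e' he')
    have hprivs : privs I' (J₀ \ F) = privs I (J₀ \ F) := privs_swapAnd I e _
    have hsat : ∀ c : Bool, SatPair I' y J₀ (({I'.vars e 2} : Finset (Fin n)), (∅ : Finset (Fin m)), c) w₂ := by
      intro c
      obtain ⟨x, hx, h1, h2'⟩ := hfv c
      refine ⟨x, fun j hj => by rw [hI', eval_swapAnd hI]; exact hx j hj, ?_, ?_⟩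
      · rw [hv2, hI', gval_swapAnd]; exact h1
      · rw [hI', gval_swapAnd]; exact h2'
    refine card_le_five_of_gateCountX₂ hC I' (isPure_swapAnd hI e) (typed_swapAnd hT e) (simpleOverlap_swapAnd hS e)
      (boundaryExpanding_swapAnd hB e) ((terminal_swapAnd hI e r y J₀ w₁ w₂).2 ht) hF ((peelable_swapAnd I e F).2 hP)
      (fun F' h1 h2 h3 => hmax F' h1 h2 ((peelable_swapAnd I e F').1 h3)) hch' he hg₀ (u := u) ?_ ?_ ?_ hsat ?_
    · rw [hvo hg₀e, hvo hg₀e, hv2]; exact hgv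
    · obtain ⟨j₀, hj₀, hju⟩ := hu'
      have hj₀e : j₀ ≠ e := fun h => (mem_sdiff.1 he).2 (h ▸ hj₀)
      exact ⟨j₀, hj₀, by rw [hvo hj₀e, hvo hj₀e]; exact hju⟩
    · intro g hg w hw
      rw [hprivs] at hw
      have hge : g ≠ e := by
        obtain ⟨-, -, -, hd₁, hd₂, -⟩ := id ht
        rcases mem_union.1 hg with hg | hg
        · exact fun h => Finset.disjoint_left.1 hd₁ (mem_sdiff.1 he).1 (h ▸ mem_of_mem_erase hg)
        · exact fun h => Finset.disjoint_left.1 hd₂ (mem_sdiff.1 he).1 (h ▸ hg)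
      rw [hvo hge, hvo hge]
      exact hun g hg w hw
    · rw [hv2, hv3]; exact (hbl' e he (Or.inr rfl)).symm

end Summit.PneNP.PneNP.Theorems.PstarGateNodesX
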